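import Summits.KontsevichZagierPeriods.KontsevichZagierPeriods.Theorems.LinRedNormalFormArrangementNormalFormSeparateTwoNormEquiv

/-!
# Coefficients against the `L¹`-norm of a polynomial on a box in dimension three

(Line `janus-bands`, crux `ArrangementNormalForm`, stub `stub_separateThreeZero`, part `HINorm` of
the termwise numerator split `separateThree_hI` under the rim condition.)

The finite-dimensional brick of the POWER COUNTING at a rim vertex on the pole plane: for
polynomials `∑ c i j k · t^i x^j y^k` of tridegree `≤ (d, d, d)` on `(Fin 2 → ℝ) × ℝ` (base point
`(x, y)`, pole coordinate `t`), every coefficient is controlled by the `L¹`-norm on a fixed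
non-degenerate box `[l, r]` (`exists_coeff_le_lone3`, registered as `separateThree_norm`).
Proof: the `L¹`-seminorm is Lipschitz in the coefficients and definite (a polynomial vanishing on
a box vanishes identically: three times the one-variable statement `SepTwo.eq_zero_of_pev_eq_zero`),
hence bounded below on the unit sphere of the coefficient space by compactness.
-/

noncomputable section

open Set MeasureTheory

namespace Summit.KontsevichZagierPeriods.ArrangementNormalForm.JanusBands

namespace SepThree

variable {d : ℕ}

/-- Coefficient arrays of tridegree `≤ (d, d, d)`. -/
abbrev Coef (d : ℕ) := Fin (d + 1) → Fin (d + 1) → Fin (d + 1) → ℝ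

/-- The polynomial `p = (v, t) ↦ ∑ᵢ (∑ⱼ ∑ₖ c i j k (v 0)^j (v 1)^k) t^i`. -/
def pev3 (c : Coef d) (p : (Fin 2 → ℝ) × ℝ) : ℝ :=
  SepTwo.pev (fun i => SepTwo.pev₂ (c i) (p.1 0) (p.1 1)) p.2

/-- `pev3` as a triple sum of monomials. -/
theorem pev3_eq (c : Coef d) (p : (Fin 2 → ℝ) × ℝ) :
    pev3 c p = ∑ i, ∑ j, ∑ k, c i j k * p.1 0 ^ (j : ℕ) * p.1 1 ^ (k : ℕ) * p.2 ^ (i : ℕ) := by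
  unfold pev3 SepTwo.pev SepTwo.pev₂
  simp only [Finset.sum_mul]

/-- `pev3 c` is continuous. -/
theorem continuous_pev3 (c : Coef d) : Continuous (pev3 c) := by
  have : pev3 c = fun p => ∑ i, ∑ j, ∑ k, c i j k * p.1 0 ^ (j : ℕ) * p.1 1 ^ (k : ℕ) * p.2 ^ (i : ℕ) :=
    funext (pev3_eq c)
  rw [this]
  fun_prop

/-- `pev3` is additive in the coefficients (difference form). -/
theorem pev3_sub (c c' : Coef d) (p : (Fin 2 → ℝ) × ℝ) :
    pev3 c p - pev3 c' p = pev3 (c - c') p := by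
  simp only [pev3_eq, Pi.sub_apply, ← Finset.sum_sub_distrib]
  refine Finset.sum_congr rfl fun i _ => Finset.sum_congr rfl fun j _ =>
    Finset.sum_congr rfl fun k _ => ?_
  ring

/-- `pev3` is homogeneous in the coefficients. -/
theorem pev3_smul (a : ℝ) (c : Coef d) (p : (Fin 2 → ℝ) × ℝ) :
    pev3 (a • c) p = a * pev3 c p := by
  simp only [pev3_eq, Pi.smul_apply, smul_eq_mul, Finset.mul_sum]
  refine Finset.sum_congr rfl fun i _ => Finset.sum_congr rfl fun j _ =>
    Finset.sum_congr rfl fun k _ => ?_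
  ring

/-- A single coefficient is bounded by the sup norm of the array. -/
theorem abs_coef_le_norm (c : Coef d) (i j k : Fin (d + 1)) : |c i j k| ≤ ‖c‖ := by
  calc |c i j k| = ‖c i j k‖ := (Real.norm_eq_abs _).symm
    _ ≤ ‖c i j‖ := norm_le_pi_norm (c i j) k
    _ ≤ ‖c i‖ := norm_le_pi_norm (c i) j
    _ ≤ ‖c‖ := norm_le_pi_norm c i

/-- Coordinates of a point of the box `[l, r]` are bounded by `‖l‖ + ‖r‖`. -/
theorem coord_bounds {l r : (Fin 2 → ℝ) × ℝ} {p : (Fin 2 → ℝ) × ℝ} (hp : p ∈ Icc l r) :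
    |p.1 0| ≤ ‖l‖ + ‖r‖ ∧ |p.1 1| ≤ ‖l‖ + ‖r‖ ∧ |p.2| ≤ ‖l‖ + ‖r‖ := by
  obtain ⟨⟨h1, h2⟩, ⟨h3, h4⟩⟩ := hp
  have hl : ∀ m, |l.1 m| ≤ ‖l‖ := fun m =>
    (Real.norm_eq_abs _).symm.le.trans ((norm_le_pi_norm l.1 m).trans (norm_fst_le l))
  have hr : ∀ m, |r.1 m| ≤ ‖r‖ := fun m =>
    (Real.norm_eq_abs _).symm.le.trans ((norm_le_pi_norm r.1 m).trans (norm_fst_le r))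
  have hl2 : |l.2| ≤ ‖l‖ := (Real.norm_eq_abs _).symm.le.trans (norm_snd_le l)
  have hr2 : |r.2| ≤ ‖r‖ := (Real.norm_eq_abs _).symm.le.trans (norm_snd_le r)
  have key : ∀ (x a b : ℝ), a ≤ x → x ≤ b → |x| ≤ |a| + |b| := fun x a b hax hxb => by
    rw [abs_le]; constructor <;> linarith [neg_abs_le a, le_abs_self b, abs_nonneg a, abs_nonneg b]
  refine ⟨(key _ _ _ (h1 0) (h3 0)).trans (add_le_add (hl 0) (hr 0)),
    (key _ _ _ (h1 1) (h3 1)).trans (add_le_add (hl 1) (hr 1)),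
    (key _ _ _ h2 h4).trans (add_le_add hl2 hr2)⟩

/-- The uniform bound `|pev3 c p| ≤ (d+1)³ R^{3d} ‖c‖` on the box, `R = 1 + ‖l‖ + ‖r‖`. -/
theorem abs_pev3_le {l r : (Fin 2 → ℝ) × ℝ} (c : Coef d) {p : (Fin 2 → ℝ) × ℝ} (hp : p ∈ Icc l r) :
    |pev3 c p| ≤ ((d + 1 : ℝ) ^ 3 * (1 + ‖l‖ + ‖r‖) ^ (3 * d)) * ‖c‖ := by
  set R := 1 + ‖l‖ + ‖r‖ with hR
  have hR1 : 1 ≤ R := by rw [hR]; linarith [norm_nonneg l, norm_nonneg r]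
  obtain ⟨hx, hy, ht⟩ := coord_bounds hp
  have hxR : |p.1 0| ≤ R := hx.trans (by rw [hR]; linarith)
  have hyR : |p.1 1| ≤ R := hy.trans (by rw [hR]; linarith)
  have htR : |p.2| ≤ R := ht.trans (by rw [hR]; linarith)
  have hpow : ∀ (x : ℝ) (m : Fin (d + 1)), |x| ≤ R → |x| ^ (m : ℕ) ≤ R ^ d := fun x m hxm =>
    (pow_le_pow_left₀ (abs_nonneg _) hxm _).trans (pow_le_pow_right₀ hR1 (Nat.lt_succ_iff.1 m.2))
  have hterm : ∀ i j k : Fin (d + 1),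
      |c i j k * p.1 0 ^ (j : ℕ) * p.1 1 ^ (k : ℕ) * p.2 ^ (i : ℕ)| ≤ R ^ (3 * d) * ‖c‖ := by
    intro i j k
    rw [abs_mul, abs_mul, abs_mul, abs_pow, abs_pow, abs_pow,
      show R ^ (3 * d) * ‖c‖ = ‖c‖ * R ^ d * R ^ d * R ^ d by ring]
    gcongr
    · exact abs_coef_le_norm c i j k
    · exact hpow _ j hxR
    · exact hpow _ k hyR
    · exact hpow _ i htR
  rw [pev3_eq]
  calc |∑ i, ∑ j, ∑ k, c i j k * p.1 0 ^ (j : ℕ) * p.1 1 ^ (k : ℕ) * p.2 ^ (i : ℕ)|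
      ≤ ∑ i, ∑ j, ∑ k, |c i j k * p.1 0 ^ (j : ℕ) * p.1 1 ^ (k : ℕ) * p.2 ^ (i : ℕ)| := by
        refine (Finset.abs_sum_le_sum_abs _ _).trans (Finset.sum_le_sum fun i _ => ?_)
        refine (Finset.abs_sum_le_sum_abs _ _).trans (Finset.sum_le_sum fun j _ => ?_)
        exact Finset.abs_sum_le_sum_abs _ _
    _ ≤ ∑ _i : Fin (d + 1), ∑ _j : Fin (d + 1), ∑ _k : Fin (d + 1), R ^ (3 * d) * ‖c‖ :=
        Finset.sum_le_sum fun i _ => Finset.sum_le_sum fun j _ => Finset.sum_le_sum fun k _ =>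
          hterm i j k
    _ = ((d + 1 : ℝ) ^ 3 * R ^ (3 * d)) * ‖c‖ := by
        simp only [Finset.sum_const, Finset.card_univ, Fintype.card_fin, nsmul_eq_mul]
        push_cast
        ring

/-- The `L¹`-seminorm of `pev3 c` on the box `[l, r]`. -/
def lone3 (l r : (Fin 2 → ℝ) × ℝ) (c : Coef d) : ℝ := ∫ p in Icc l r, |pev3 c p|

/-- `|pev3 c|` is integrable on the box. -/
theorem integrableOn_pev3 (l r : (Fin 2 → ℝ) × ℝ) (c : Coef d) :
    IntegrableOn (fun p => |pev3 c p|) (Icc l r) :=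
  (continuous_pev3 c).abs.continuousOn.integrableOn_compact isCompact_Icc

/-- The `L¹`-seminorm is Lipschitz in the coefficients. -/
theorem abs_lone3_sub_le (l r : (Fin 2 → ℝ) × ℝ) (c c' : Coef d) :
    |lone3 l r c - lone3 l r c'| ≤
      ((d + 1 : ℝ) ^ 3 * (1 + ‖l‖ + ‖r‖) ^ (3 * d)) * (volume (Icc l r)).toReal * ‖c - c'‖ := by
  set L := (d + 1 : ℝ) ^ 3 * (1 + ‖l‖ + ‖r‖) ^ (3 * d) with hL
  have hsub : lone3 l r c - lone3 l r c' = ∫ p in Icc l r, (|pev3 c p| - |pev3 c' p|) := by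
    unfold lone3
    rw [integral_sub (integrableOn_pev3 l r c) (integrableOn_pev3 l r c')]
  rw [hsub]
  have hb : ∀ p ∈ Icc l r, ‖|pev3 c p| - |pev3 c' p|‖ ≤ L * ‖c - c'‖ := fun p hp => by
    rw [Real.norm_eq_abs]
    calc |(|pev3 c p| - |pev3 c' p|)| ≤ |pev3 c p - pev3 c' p| := abs_abs_sub_abs_le_abs_sub _ _
      _ = |pev3 (c - c') p| := by rw [pev3_sub]
      _ ≤ L * ‖c - c'‖ := abs_pev3_le (c - c') hp
  have h := norm_setIntegral_le_of_norm_le_const (measure_Icc_lt_top (μ := volume)) hb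
  rw [Real.norm_eq_abs] at h
  calc |∫ p in Icc l r, (|pev3 c p| - |pev3 c' p|)| ≤ L * ‖c - c'‖ * (volume.real (Icc l r)) := h
    _ = L * (volume (Icc l r)).toReal * ‖c - c'‖ := by rw [Measure.real]; ring

/-- The `L¹`-seminorm is continuous in the coefficients. -/
theorem continuous_lone3 (l r : (Fin 2 → ℝ) × ℝ) : Continuous (lone3 (d := d) l r) := by
  set K := ((d + 1 : ℝ) ^ 3 * (1 + ‖l‖ + ‖r‖) ^ (3 * d)) * (volume (Icc l r)).toReal with hK
  have hK0 : 0 ≤ K := by positivity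
  refine Metric.continuous_iff.2 fun c ε hε => ⟨ε / (K + 1), by positivity, fun c' hc' => ?_⟩
  rw [Real.dist_eq]
  rw [dist_eq_norm] at hc'
  calc |lone3 l r c' - lone3 l r c| ≤ K * ‖c' - c‖ := abs_lone3_sub_le l r c' c
    _ ≤ K * (ε / (K + 1)) := mul_le_mul_of_nonneg_left hc'.le hK0
    _ < ε := by rw [mul_div_assoc']; rw [div_lt_iff₀ (by positivity)]; nlinarith

/-- The `L¹`-seminorm is absolutely homogeneous. -/
theorem lone3_smul (l r : (Fin 2 → ℝ) × ℝ) (a : ℝ) (c : Coef d) :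
    lone3 l r (a • c) = |a| * lone3 l r c := by
  unfold lone3
  simp only [pev3_smul, abs_mul]
  exact integral_const_mul _ _

/-! ### Definiteness -/

/-- A polynomial vanishing on a non-degenerate box has all coefficients zero. -/
theorem coef_eq_zero_of_forall {l r : (Fin 2 → ℝ) × ℝ} (h1 : ∀ m, l.1 m < r.1 m) (h2 : l.2 < r.2)
    (c : Coef d) (h : ∀ p ∈ Icc l r, pev3 c p = 0) : c = 0 := by
  -- first the `t`-coefficients, at every base point of the box
  have step1 : ∀ x ∈ Icc (l.1 0) (r.1 0), ∀ y ∈ Icc (l.1 1) (r.1 1), ∀ i,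
      SepTwo.pev₂ (c i) x y = 0 := by
    intro x hx y hy
    have hv : (fun i => SepTwo.pev₂ (c i) x y) = 0 := by
      refine SepTwo.eq_zero_of_pev_eq_zero h2 _ fun t ht => ?_
      have hp : ((![x, y] : Fin 2 → ℝ), t) ∈ Icc l r := by
        refine ⟨⟨fun m => ?_, ht.1⟩, ⟨fun m => ?_, ht.2⟩⟩ <;> fin_cases m
        · exact hx.1
        · exact hy.1
        · exact hx.2
        · exact hy.2
      have := h _ hp
      simpa [pev3] using this
    intro i
    exact congrFun hv i
  -- then the `y`-coefficients, then the `x`-coefficients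
  funext i j k
  have step2 : ∀ x ∈ Icc (l.1 0) (r.1 0), (fun k' => SepTwo.pev (fun j' => c i j' k') x) = 0 := by
    intro x hx
    refine SepTwo.eq_zero_of_pev_eq_zero (h1 1) _ fun y hy => ?_
    have := step1 x hx y hy i
    rwa [SepTwo.pev₂_eq] at this
  have step3 : (fun j' => c i j' k) = 0 := by
    refine SepTwo.eq_zero_of_pev_eq_zero (h1 0) _ fun x hx => ?_
    exact congrFun (step2 x hx) k
  exact congrFun step3 j

/-- A polynomial with vanishing `L¹`-seminorm on a non-degenerate box is zero. -/
theorem coef_eq_zero_of_lone3_eq_zero {l r : (Fin 2 → ℝ) × ℝ} (h1 : ∀ m, l.1 m < r.1 m)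
    (h2 : l.2 < r.2) (c : Coef d) (h : lone3 l r c = 0) : c = 0 := by
  -- a smaller closed box, every point of which is interior to `[l, r]`
  set l' : (Fin 2 → ℝ) × ℝ := (fun m => (2 * l.1 m + r.1 m) / 3, (2 * l.2 + r.2) / 3) with hl'
  set r' : (Fin 2 → ℝ) × ℝ := (fun m => (l.1 m + 2 * r.1 m) / 3, (l.2 + 2 * r.2) / 3) with hr'
  have h1' : ∀ m, l'.1 m < r'.1 m := fun m => by
    simp only [hl', hr']; have := h1 m; linarith
  have h2' : l'.2 < r'.2 := by simp only [hl', hr']; linarith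
  refine coef_eq_zero_of_forall h1' h2' c fun p₀ hp₀ => ?_
  by_contra hne
  -- a margin `η` around `p₀` inside `[l, r]`
  set η : ℝ := min (min ((r.1 0 - l.1 0) / 3) ((r.1 1 - l.1 1) / 3)) ((r.2 - l.2) / 3) with hη
  have hη0 : 0 < η := by
    simp only [hη, lt_min_iff]
    exact ⟨⟨by linarith [h1 0], by linarith [h1 1]⟩, by linarith⟩
  have hball_sub : Metric.ball p₀ η ⊆ Icc l r := by
    intro p hp
    rw [Metric.mem_ball, dist_eq_norm] at hp
    have hc1 : ∀ m, |p.1 m - p₀.1 m| < η := fun m => by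
      calc |p.1 m - p₀.1 m| = ‖(p - p₀).1 m‖ := by simp [Real.norm_eq_abs]
        _ ≤ ‖(p - p₀).1‖ := norm_le_pi_norm _ m
        _ ≤ ‖p - p₀‖ := norm_fst_le _
        _ < η := hp
    have hc2 : |p.2 - p₀.2| < η := by
      calc |p.2 - p₀.2| = ‖(p - p₀).2‖ := by simp [Real.norm_eq_abs]
        _ ≤ ‖p - p₀‖ := norm_snd_le _
        _ < η := hp
    obtain ⟨⟨hp1, hp2⟩, ⟨hp3, hp4⟩⟩ := hp₀
    have hη1 : ∀ m, η ≤ (r.1 m - l.1 m) / 3 := fun m => by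
      fin_cases m
      · exact (min_le_left _ _).trans (min_le_left _ _)
      · exact (min_le_left _ _).trans (min_le_right _ _)
    have hη2 : η ≤ (r.2 - l.2) / 3 := min_le_right _ _
    refine ⟨⟨fun m => ?_, ?_⟩, ⟨fun m => ?_, ?_⟩⟩
    · have := hc1 m; have := hp1 m; have := hη1 m
      simp only [hl'] at *; rw [abs_lt] at *; linarith
    · simp only [hl'] at hp2; rw [abs_lt] at hc2; linarith
    · have := hc1 m; have := hp3 m; have := hη1 m
      simp only [hr'] at *; rw [abs_lt] at *; linarith
    · simp only [hr'] at hp4; rw [abs_lt] at hc2; linarith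
  -- `|pev3 c| ≥ ε/2` on a smaller ball
  set ε := |pev3 c p₀| with hε
  have hε0 : 0 < ε := abs_pos.2 hne
  have hcont := (continuous_pev3 c).abs.continuousAt (x := p₀)
  obtain ⟨δ, hδ0, hδ⟩ := Metric.continuousAt_iff.1 hcont (ε / 2) (half_pos hε0)
  set ρ := min δ η with hρ
  have hρ0 : 0 < ρ := lt_min hδ0 hη0
  have hlow : ∀ p ∈ Metric.ball p₀ ρ, ε / 2 ≤ |pev3 c p| := fun p hp => by
    have := hδ (lt_of_lt_of_le hp (min_le_left _ _))
    rw [Real.dist_eq, abs_lt] at this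
    linarith
  have hsub : Metric.ball p₀ ρ ⊆ Icc l r :=
    (Metric.ball_subset_ball (min_le_right _ _)).trans hball_sub
  -- the integral over the ball is positive, contradicting `lone3 c = 0`
  have hpos : 0 < ∫ p in Metric.ball p₀ ρ, |pev3 c p| := by
    calc (0 : ℝ) < (volume (Metric.ball p₀ ρ)).toReal * (ε / 2) := by
          refine mul_pos (ENNReal.toReal_pos (Metric.measure_ball_pos volume p₀ hρ0).ne' ?_)
            (half_pos hε0)
          exact (measure_mono hsub).trans_lt (measure_Icc_lt_top (μ := volume)) |>.ne
      _ = ∫ _ in Metric.ball p₀ ρ, ε / 2 := by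
          rw [setIntegral_const, smul_eq_mul, Measure.real]
      _ ≤ ∫ p in Metric.ball p₀ ρ, |pev3 c p| := by
          refine setIntegral_mono_on (integrableOn_const ?_)
            ((integrableOn_pev3 l r c).mono_set hsub) measurableSet_ball hlow
          exact (measure_mono hsub).trans_lt (measure_Icc_lt_top (μ := volume)) |>.ne
  have hle : ∫ p in Metric.ball p₀ ρ, |pev3 c p| ≤ lone3 l r c :=
    setIntegral_mono_set (integrableOn_pev3 l r c) (ae_of_all _ fun _ => abs_nonneg _)
      (ae_of_all _ hsub)
  rw [h] at hle
  exact absurd (hpos.trans_le hle) (lt_irrefl 0)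

/-! ### Norm equivalence -/

/-- **Norm equivalence in dimension three.** Every coefficient of `pev3 c` is bounded by the
`L¹`-norm of `pev3 c` on the box `[l, r]`, with a constant depending only on `d`, `l`, `r`. -/
theorem exists_coeff_le_lone3 (d : ℕ) {l r : (Fin 2 → ℝ) × ℝ} (h1 : ∀ m, l.1 m < r.1 m)
    (h2 : l.2 < r.2) :
    ∃ C : ℝ, 0 < C ∧ ∀ (c : Coef d) (i j k : Fin (d + 1)), |c i j k| ≤ C * lone3 l r c := by
  set S : Set (Coef d) := Metric.sphere 0 1 with hS
  have hScpt : IsCompact S := isCompact_sphere 0 1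
  have hSne : S.Nonempty := NormedSpace.sphere_nonempty.2 zero_le_one
  obtain ⟨c₀, hc₀S, hmin⟩ := hScpt.exists_isMinOn hSne (continuous_lone3 l r).continuousOn
  set m := lone3 l r c₀ with hm
  have hm0 : 0 < m := by
    have hnn : 0 ≤ m := setIntegral_nonneg measurableSet_Icc fun _ _ => abs_nonneg _
    rcases hnn.lt_or_eq with hlt | heq
    · exact hlt
    · exfalso
      have h0 := coef_eq_zero_of_lone3_eq_zero h1 h2 c₀ heq.symm
      rw [hS, mem_sphere_zero_iff_norm, h0, norm_zero] at hc₀S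
      exact zero_ne_one hc₀S
  refine ⟨m⁻¹, inv_pos.2 hm0, fun c i j k => ?_⟩
  by_cases hc : c = 0
  · subst hc
    have : lone3 l r (0 : Coef d) = 0 := by
      have h := lone3_smul l r 0 (0 : Coef d)
      rwa [zero_smul, abs_zero, zero_mul] at h
    simp [this]
  · have hn : 0 < ‖c‖ := norm_pos_iff.2 hc
    set u : Coef d := ‖c‖⁻¹ • c with hu
    have huS : u ∈ S := by
      rw [hS, mem_sphere_zero_iff_norm, hu, norm_smul, norm_inv, norm_norm, inv_mul_cancel₀ hn.ne']
    have hcu : c = ‖c‖ • u := by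
      rw [hu, smul_smul, mul_inv_cancel₀ hn.ne', one_smul]
    have hlone : lone3 l r c = ‖c‖ * lone3 l r u := by
      rw [hcu, lone3_smul, abs_norm]; rw [← hcu]
    have hmu : m ≤ lone3 l r u := hmin huS
    calc |c i j k| ≤ ‖c‖ := abs_coef_le_norm c i j k
      _ = m⁻¹ * (‖c‖ * m) := by field_simp
      _ ≤ m⁻¹ * (‖c‖ * lone3 l r u) := by gcongr
      _ = m⁻¹ * lone3 l r c := by rw [hlone]

end SepThree

/-- **Norm equivalence for polynomials on a box in dimension three** (registered part of
`stub_separateThreeZero`; literal form of `SepThree.exists_coeff_le_lone3`): on a non-degenerate box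
`[l, r] ⊆ (Fin 2 → ℝ) × ℝ`, every coefficient of `∑ c i j k · (v 0)^j (v 1)^k t^i` is bounded by
the `L¹`-norm on the box, with a constant depending only on `d`, `l`, `r`. -/
theorem separateThree_norm (d : ℕ) (l r : (Fin 2 → ℝ) × ℝ) (h1 : ∀ m, l.1 m < r.1 m) (h2 : l.2 < r.2) : ∃ C : ℝ, 0 < C ∧ ∀ (c : Fin (d + 1) → Fin (d + 1) → Fin (d + 1) → ℝ) (i j k : Fin (d + 1)), |c i j k| ≤ C * ∫ p in Set.Icc l r, |∑ i' : Fin (d + 1), ∑ j' : Fin (d + 1), ∑ k' : Fin (d + 1), c i' j' k' * p.1 0 ^ (j' : ℕ) * p.1 1 ^ (k' : ℕ) * p.2 ^ (i' : ℕ)| := by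
  obtain ⟨C, hC, h⟩ := SepThree.exists_coeff_le_lone3 d h1 h2
  refine ⟨C, hC, fun c i j k => ?_⟩
  have := h c i j k
  simpa only [SepThree.lone3, SepThree.pev3_eq] using this

end Summit.KontsevichZagierPeriods.ArrangementNormalForm.JanusBands
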